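import Literature.AlgebraicGeometry.FormalGeometry.WittGERelativeFormalFunctions
import Literature.AlgebraicGeometry.Morphisms.FormalModuleCompletion
import Literature.AlgebraicGeometry.Modules.PushforwardClosedImmersionExact
import Literature.AlgebraicGeometry.Modules.KilledByLocal
import Literature.AlgebraicGeometry.Modules.IdealSheafNoetherian
import Literature.AlgebraicGeometry.Modules.SectionsExact
import Literature.AlgebraicGeometry.Morphisms.CohAffineExactness
import HarnessLib

/-!
# The push–pull comparison `(ρ_*G)^ → ρ_*(G^)` of completion towers is an `a`-power isogeny

Helper file toward the crux `PadicSemiregularLift.FormalVectorBundlesAlgebraize`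
(stmt-HodgeConjecture-14106), proper case via a Chow cover (Stacks 088B "push–pull of inverse
systems"; Görtz–Wedhorn II, Construction 24.104 and Lemma 24.105).

Let `ρ : X' → X` be proper, `X` locally noetherian and quasi-compact, `a ∈ Γ(X, 𝒪_X)`, `a' = ρ♯(a)`
and `G` a coherent `𝒪_{X'}`-module; `H = ρ_*G` is coherent (`Morphisms/ProperPushforwardCoh`). The
canonical morphism of towers

  `v : H^ = (H/aⁿ⁺¹H)_n → (ρ_*(G/a'ⁿ⁺¹G))_n`

(`exists_pushforwardCmplComparison`; induced by `ρ_*` of the quotient maps) has, UNIFORMLY in `n`,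
kernels and cokernels killed by a fixed power of `a`: this is the theorem on formal functions in
degree `0` (GW II Thm. 24.37 / Lemma 24.40 for `p = 0`, `I = (a)`) over the members of a finite
affine cover of `X` (`…AlgebraizeRelativeFormalFunctions`), globalised through the
affine-localizing property of the coherent modules involved (`Modules/KilledByLocal`):

* `pushforwardCmplComparison_kernel_torsion` — `∃ c, ∀ n, ker(v_n) · aᶜ = 0`;
* `pushforwardCmplComparison_cokernel_torsion` — `∃ c, ∀ n, aᶜ · coker(v_n) = 0`.

Everything is proved; no definitions.

Provenance: Literature home (family `hodge`, layer `Literature/AlgebraicGeometry/FormalGeometry`, namespace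
`Literature.AlgebraicGeometry.FormalGeometry.WittGrothendieckExistence…`) of the Summits-side
`Theorems/PadicSemiregularLiftFormalVectorBundlesAlgebraizePushforwardComparison` (route `PadicSemiregularLift` / `AnchorTransport`,
Grothendieck existence for vector bundles over `W(k)`), which `Literature/` may not import; theorems only, no
named fact, no definition. Lane `lit-hodgefound`, seat p20.
-/

noncomputable section

-- `TopCat.Presheaf`/`Scheme.Modules` are not reducible (as in Mathlib's `AlgebraicGeometry/Modules`).
set_option backward.isDefEq.respectTransparency false

open CategoryTheory CategoryTheory.Limits _root_.AlgebraicGeometry TopologicalSpace Opposite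
open Literature.AlgebraicGeometry.Modules Literature.AlgebraicGeometry.Morphisms
open Literature.AlgebraicGeometry.Motives (Scheme.Modules.Hom.app_map_apply)

universe u

namespace Literature.AlgebraicGeometry.FormalGeometry.WittGrothendieckExistence.FormalVectorBundlesAlgebraize

/-- Composites act on sections by composition. [cite: GortzWedhorn2023, proof of Thm. 24.94 and Prop. 24.95 (pp. 566–567), auxiliary step] -/
private theorem pc_comp_app_apply {Y : Scheme.{u}} {M N K : Y.Modules} (φ : M ⟶ N) (ψ : N ⟶ K)
    (U : Y.Opens) (x : Γ(M, U)) : (φ ≫ ψ).app U x = ψ.app U (φ.app U x) := rfl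

/-- The zero morphism acts by zero on sections. [cite: GortzWedhorn2023, proof of Thm. 24.94 and Prop. 24.95 (pp. 566–567), auxiliary step] -/
private theorem pc_zero_app_apply {Y : Scheme.{u}} {M N : Y.Modules} (U : Y.Opens) (x : Γ(M, U)) :
    (0 : M ⟶ N).app U x = 0 := rfl

variable {X' X : Scheme.{u}} (ρ : X' ⟶ X) (a : Γ(X, ⊤)) (G : X'.Modules)

/-! ### The comparison map of towers -/

/-- `ρ_*` carries multiplication by `a'ᵐ` on `G` to multiplication by `aᵐ` on `ρ_*G`. [cite: GortzWedhorn2023, proof of Thm. 24.94 and Prop. 24.95 (pp. 566–567), auxiliary step] -/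
theorem pushforward_map_globalScalar_pow (m : ℕ) :
    (Scheme.Modules.pushforward ρ).map (globalScalar G (ρ.appTop a ^ m)) =
      globalScalar ((Scheme.Modules.pushforward ρ).obj G) (a ^ m) := by
  rw [← map_pow, pushforward_map_globalScalar]

/-- Bookkeeping: the `X`-scalar `aᵐ|_V` acts on `Γ(V, ρ_*N) = Γ(ρ⁻¹V, N)` as `a'ᵐ|_{ρ⁻¹V}`. [cite: GortzWedhorn2023, proof of Thm. 24.94 and Prop. 24.95 (pp. 566–567), auxiliary step] -/
theorem pow_smul_pushforward_section (N : X'.Modules) (m : ℕ) (V : X.Opens)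
    (t : Γ((Scheme.Modules.pushforward ρ).obj N, V)) :
    X.presheaf.map (homOfLE (le_top : V ≤ ⊤)).op (a ^ m) • t =
      (globalScalar N (ρ.appTop a ^ m)).app (ρ ⁻¹ᵁ V) (show Γ(N, ρ ⁻¹ᵁ V) from t) := by
  rw [pushforward_smul, globalScalar_app_apply, ← map_pow, app_restrict_eq_restrict_appTop]

/-- **The push–pull comparison of completion towers** `v : (ρ_*G)^ → ρ_*(G^)`: the morphism of
towers `(ρ_*G)/aⁿ⁺¹(ρ_*G) → ρ_*(G/a'ⁿ⁺¹G)` induced by `ρ_*` of the quotient maps of `G`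
(GW II Construction 24.104; Stacks 088B). [cite: GortzWedhorn2023, proof of Thm. 24.94 and Prop. 24.95 (pp. 566–567), auxiliary step] -/
theorem exists_pushforwardCmplComparison :
    ∃ v : cmplTower a ((Scheme.Modules.pushforward ρ).obj G) ⟶
        cmplTower (ρ.appTop a) G ⋙ Scheme.Modules.pushforward ρ,
      ∀ n : ℕ, cmplπ a ((Scheme.Modules.pushforward ρ).obj G) n ≫ v.app ⟨n⟩ =
        (Scheme.Modules.pushforward ρ).map (cmplπ (ρ.appTop a) G n) := by
  have hzero : ∀ n : ℕ, globalScalar ((Scheme.Modules.pushforward ρ).obj G) (a ^ (n + 1)) ≫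
      (Scheme.Modules.pushforward ρ).map (cmplπ (ρ.appTop a) G n) = 0 := fun n => by
    rw [← pushforward_map_globalScalar_pow, ← Functor.map_comp]
    change (Scheme.Modules.pushforward ρ).map
      (globalScalar G (ρ.appTop a ^ (n + 1)) ≫ cokernel.π _) = 0
    rw [cokernel.condition, Functor.map_zero]
  let vn : ∀ n : ℕ, cmplObj a ((Scheme.Modules.pushforward ρ).obj G) n ⟶
      (Scheme.Modules.pushforward ρ).obj (cmplObj (ρ.appTop a) G n) :=
    fun n => cokernel.desc _ _ (hzero n)
  have hvn : ∀ n, cmplπ a ((Scheme.Modules.pushforward ρ).obj G) n ≫ vn n =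
      (Scheme.Modules.pushforward ρ).map (cmplπ (ρ.appTop a) G n) :=
    fun n => cokernel.π_desc _ _ _
  refine ⟨NatTrans.ofOpSequence vn fun n => ?_, fun n => hvn n⟩
  change towerπ (cmplTower a ((Scheme.Modules.pushforward ρ).obj G)) n ≫ vn n =
    vn (n + 1) ≫ (Scheme.Modules.pushforward ρ).map (towerπ (cmplTower (ρ.appTop a) G) n)
  rw [towerπ_cmplTower, towerπ_cmplTower,
    ← cancel_epi (cmplπ a ((Scheme.Modules.pushforward ρ).obj G) (n + 1)), cmplπ_cmplStep_assoc,
    hvn, reassoc_of% (hvn (n + 1)), ← Functor.map_comp, cmplπ_cmplStep]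

/-! ### Uniform torsion bounds for kernel and cokernel -/

section Torsion

variable [IsProper ρ] [IsLocallyNoetherian X] [CompactSpace X] {G}

/-- **The kernels of the push–pull comparison are killed by a fixed power of `a`.** For
`ρ : X' → X` proper, `X` locally noetherian and quasi-compact, `G` coherent on `X'` and
`v : (ρ_*G)^ → ρ_*(G^)` the comparison of completion towers, there is `c` with
`ker(v_n) · aᶜ = 0` for every `n` (the Artin–Rees half of the theorem on formal functions over a
finite affine cover of `X`; GW II Lemma 24.105, Stacks 088B). [cite: GortzWedhorn2023, proof of Thm. 24.94 and Prop. 24.95 (pp. 566–567), auxiliary step] -/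
theorem pushforwardCmplComparison_kernel_torsion (hG : Coh G)
    (v : cmplTower a ((Scheme.Modules.pushforward ρ).obj G) ⟶
      cmplTower (ρ.appTop a) G ⋙ Scheme.Modules.pushforward ρ)
    (hv : ∀ n : ℕ, cmplπ a ((Scheme.Modules.pushforward ρ).obj G) n ≫ v.app ⟨n⟩ =
      (Scheme.Modules.pushforward ρ).map (cmplπ (ρ.appTop a) G n)) :
    ∃ c : ℕ, ∀ n : ℕ, kernel.ι (v.app ⟨n⟩) ≫
      globalScalar ((cmplTower a ((Scheme.Modules.pushforward ρ).obj G)).obj ⟨n⟩) (a ^ c) = 0 := by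
  classical
  haveI : IsLocallyNoetherian X' := LocallyOfFiniteType.isLocallyNoetherian ρ
  haveI : CompactSpace X' := QuasiCompact.compactSpace_of_compactSpace ρ
  have hH : Coh ((Scheme.Modules.pushforward ρ).obj G) := coh_pushforward_of_isProper ρ hG
  -- a finite affine cover of `X` and a uniform Artin–Rees shift
  obtain ⟨T, hT⟩ := exists_finite_affineOpens_iSup_eq_top (X := X)
  choose c hc using fun V : T => exists_ar_shift_over_affine ρ a (V := (V : X.affineOpens))
    (V : X.affineOpens).2 hG
  obtain ⟨C, hcC⟩ : ∃ C : ℕ, ∀ V : T, c V ≤ C :=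
    ⟨Finset.univ.sup c, fun V => Finset.le_sup (f := c) (Finset.mem_univ V)⟩
  refine ⟨C, fun n => ?_⟩
  -- it suffices that `a^C` kills the (coherent) kernel, which is checked on the cover
  have hker : Coh (kernel (v.app ⟨n⟩)) :=
    Coh.kernel _ (coh_cmplTower a hH n)
      (coh_pushforward_of_isProper ρ (coh_cmplTower (ρ.appTop a) hG n))
  suffices hzero : globalScalar (kernel (v.app ⟨n⟩)) (a ^ C) = 0 by
    rw [← globalScalar_comp, hzero, zero_comp]
  refine eq_zero_of_app_eq_zero_of_iSup_eq_top _ hker.loc (fun V : T => (V : X.affineOpens)) hT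
    fun V z => ?_
  have hcV : c V ≤ C := hcC V
  apply kernel_ι_app_injective (v.app ⟨n⟩) (V : X.Opens)
  rw [map_zero, ← pc_comp_app_apply, globalScalar_comp, pc_comp_app_apply]
  -- the section `ι(z)` of `H/aⁿ⁺¹H` over `V` lifts to `h ∈ Γ(ρ⁻¹V, G)`
  obtain ⟨h, hh⟩ := app_surjective_of_epi (cmplπ a ((Scheme.Modules.pushforward ρ).obj G) n)
    hH.loc (coh_cmplTower a hH n).loc (V : X.affineOpens).2 ((kernel.ι (v.app ⟨n⟩)).app (V : X.Opens) z)
  -- its class in `Γ(ρ⁻¹V, G/a'ⁿ⁺¹G)` vanishes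
  have hv0 : (v.app ⟨n⟩).app (V : X.Opens) ((kernel.ι (v.app ⟨n⟩)).app (V : X.Opens) z) = 0 := by
    rw [← pc_comp_app_apply, kernel.condition, pc_zero_app_apply]
  have hG0 : (cokernel.π (globalScalar G (ρ.appTop a ^ (n + 1)))).app (ρ ⁻¹ᵁ (V : X.Opens))
      (h : Γ(G, ρ ⁻¹ᵁ (V : X.Opens))) = 0 := by
    have e1 := congrArg (fun φ => φ.app (V : X.Opens) h) (hv n)
    dsimp only at e1
    rw [pc_comp_app_apply, hh] at e1
    exact e1.symm.trans hv0
  rw [← hh]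
  change (cmplπ a ((Scheme.Modules.pushforward ρ).obj G) n ≫
    globalScalar (cmplObj a ((Scheme.Modules.pushforward ρ).obj G) n) (a ^ C)).app
      (V : X.Opens) h = 0
  -- Artin–Rees: either `a^C` kills the whole level, or `h ∈ a'ⁿ⁺¹⁻ᶜ Γ(ρ⁻¹V, G)`
  by_cases hle : C ≤ n + 1
  · obtain ⟨m, hm⟩ : ∃ m, n + 1 = m + (c V) + (C - c V) := by
      exact ⟨n + 1 - C, by omega⟩
    have hG0' : (cokernel.π (globalScalar G
        (ρ.appTop a ^ (m + (C - c V) + c V)))).app (ρ ⁻¹ᵁ (V : X.Opens))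
        (h : Γ(G, ρ ⁻¹ᵁ (V : X.Opens))) = 0 := by
      rw [show m + (C - c V) + c V = n + 1 by omega]; exact hG0
    obtain ⟨u, hu⟩ := hc V _ _ hG0'
    have hcomp : (Scheme.Modules.pushforward ρ).map
        (globalScalar G (ρ.appTop a ^ (m + (C - c V)))) ≫
        cmplπ a ((Scheme.Modules.pushforward ρ).obj G) n ≫
        globalScalar (cmplObj a ((Scheme.Modules.pushforward ρ).obj G) n)
          (a ^ C) = 0 := by
      rw [pushforward_map_globalScalar_pow, globalScalar_comp_assoc, ← globalScalar_mul, ← pow_add,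
        show C + (m + (C - c V)) =
          (C - c V) + (n + 1) by omega,
        pow_add, globalScalar_mul, globalScalar_cmplObj_eq_zero, zero_comp, comp_zero]
    rw [hu]
    change ((Scheme.Modules.pushforward ρ).map
        (globalScalar G (ρ.appTop a ^ (m + (C - c V)))) ≫
      cmplπ a ((Scheme.Modules.pushforward ρ).obj G) n ≫
      globalScalar (cmplObj a ((Scheme.Modules.pushforward ρ).obj G) n)
        (a ^ C)).app (V : X.Opens) u = 0
    rw [hcomp, pc_zero_app_apply]
  · -- `a^C = a^(C-(n+1)) a^(n+1)` kills `H/aⁿ⁺¹H`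
    have hk : globalScalar (cmplObj a ((Scheme.Modules.pushforward ρ).obj G) n)
        (a ^ C) = 0 := by
      rw [show C = (C - (n + 1)) + (n + 1) by omega, pow_add,
        globalScalar_mul, globalScalar_cmplObj_eq_zero, zero_comp]
    rw [hk, comp_zero, pc_zero_app_apply]

/-- **The cokernels of the push–pull comparison are killed by a fixed power of `a`.** For
`ρ : X' → X` proper, `X` locally noetherian and quasi-compact, `G` coherent on `X'` and
`v : (ρ_*G)^ → ρ_*(G^)` the comparison of completion towers, there is `c` with
`aᶜ · coker(v_n) = 0` for every `n` (the Mittag-Leffler half of the theorem on formal functions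
over a finite affine cover of `X`; GW II Lemma 24.40 / 24.105, Stacks 088B). [cite: GortzWedhorn2023, proof of Thm. 24.94 and Prop. 24.95 (pp. 566–567), auxiliary step] -/
theorem pushforwardCmplComparison_cokernel_torsion (hG : Coh G)
    (v : cmplTower a ((Scheme.Modules.pushforward ρ).obj G) ⟶
      cmplTower (ρ.appTop a) G ⋙ Scheme.Modules.pushforward ρ)
    (hv : ∀ n : ℕ, cmplπ a ((Scheme.Modules.pushforward ρ).obj G) n ≫ v.app ⟨n⟩ =
      (Scheme.Modules.pushforward ρ).map (cmplπ (ρ.appTop a) G n)) :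
    ∃ c : ℕ, ∀ n : ℕ,
      globalScalar ((cmplTower (ρ.appTop a) G ⋙ Scheme.Modules.pushforward ρ).obj ⟨n⟩) (a ^ c) ≫
        cokernel.π (v.app ⟨n⟩) = 0 := by
  classical
  haveI : IsLocallyNoetherian X' := LocallyOfFiniteType.isLocallyNoetherian ρ
  haveI : CompactSpace X' := QuasiCompact.compactSpace_of_compactSpace ρ
  have hH : Coh ((Scheme.Modules.pushforward ρ).obj G) := coh_pushforward_of_isProper ρ hG
  obtain ⟨T, hT⟩ := exists_finite_affineOpens_iSup_eq_top (X := X)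
  choose c hc using fun V : T => exists_ml_shift_over_affine ρ a (V := (V : X.affineOpens))
    (V : X.affineOpens).2 hG
  obtain ⟨C, hcC⟩ : ∃ C : ℕ, ∀ V : T, c V ≤ C :=
    ⟨Finset.univ.sup c, fun V => Finset.le_sup (f := c) (Finset.mem_univ V)⟩
  refine ⟨C, fun n => ?_⟩
  -- the level `n` target `P_n = ρ_*(G/a'ⁿ⁺¹G)` is coherent
  have hP : Coh ((Scheme.Modules.pushforward ρ).obj (cmplObj (ρ.appTop a) G n)) :=
    coh_pushforward_of_isProper ρ (coh_cmplTower (ρ.appTop a) hG n)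
  -- "multiplication by `a'^C`" `G/a'ⁿ⁺¹G → G/a'ⁿ⁺ᶜ⁺¹G` and the reduction back
  have hμ0 : globalScalar G (ρ.appTop a ^ (n + 1)) ≫
      (globalScalar G (ρ.appTop a ^ C) ≫
        cmplπ (ρ.appTop a) G (n + C)) = 0 := by
    rw [← Category.assoc, ← globalScalar_mul, ← pow_add,
      show C + (n + 1) = n + C + 1 by omega]
    exact cokernel.condition _
  obtain ⟨r, hr⟩ := exists_reduction G (q := ρ.appTop a ^ (n + 1))
    (q' := ρ.appTop a ^ (n + C + 1)) (d := ρ.appTop a ^ C)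
    (by rw [← pow_add]; congr 1; omega)
  have hμr : cokernel.desc _ _ hμ0 ≫ r =
      globalScalar (cmplObj (ρ.appTop a) G n) (ρ.appTop a ^ C) := by
    rw [← cancel_epi (cmplπ (ρ.appTop a) G n), cokernel.π_desc_assoc, Category.assoc, hr,
      globalScalar_comp]
  change globalScalar ((Scheme.Modules.pushforward ρ).obj (cmplObj (ρ.appTop a) G n))
    (a ^ C) ≫ cokernel.π (v.app ⟨n⟩) = 0
  refine eq_zero_of_app_eq_zero_of_iSup_eq_top _ hP.loc (fun V : T => (V : X.affineOpens)) hT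
    fun V t => ?_
  rw [pc_comp_app_apply, globalScalar_app_apply]
  -- `a^C • t = [s]` for a section `s ∈ Γ(ρ⁻¹V, G)` (Mittag-Leffler with shift `c V ≤ C`)
  obtain ⟨s, hs⟩ := hc V (n + 1) (n + C + 1) (by have := hcC V; omega) r hr
    ((cokernel.desc _ _ hμ0).app (ρ ⁻¹ᵁ (V : X.Opens))
      (t : Γ(cmplObj (ρ.appTop a) G n, ρ ⁻¹ᵁ (V : X.Opens))))
  have hst : (cmplπ (ρ.appTop a) G n).app (ρ ⁻¹ᵁ (V : X.Opens)) s =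
      X.presheaf.map (homOfLE (le_top : (V : X.Opens) ≤ ⊤)).op (a ^ C) • t := by
    change (cokernel.π (globalScalar G (ρ.appTop a ^ (n + 1)))).app _ s = _
    rw [hs, ← pc_comp_app_apply, hμr, pow_smul_pushforward_section]
  -- hence `a^C • t = v_n([s])` dies in the cokernel
  have hvs : (cmplπ a ((Scheme.Modules.pushforward ρ).obj G) n ≫ v.app ⟨n⟩).app (V : X.Opens) s =
      X.presheaf.map (homOfLE (le_top : (V : X.Opens) ≤ ⊤)).op (a ^ C) • t := by
    rw [hv n]
    exact hst
  rw [← hvs]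
  change (cmplπ a ((Scheme.Modules.pushforward ρ).obj G) n ≫ v.app ⟨n⟩ ≫
    cokernel.π (v.app ⟨n⟩)).app (V : X.Opens) s = 0
  rw [cokernel.condition, comp_zero, pc_zero_app_apply]

end Torsion

end Literature.AlgebraicGeometry.FormalGeometry.WittGrothendieckExistence.FormalVectorBundlesAlgebraize

end
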